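import Mathlib
import Summits.ValiantsHypothesis.ValiantsHypothesis.Theorems.BarrierLeverPartitionMinorsHitByVPSimplexJoinBoxGameSquareDrain
import Summits.ValiantsHypothesis.ValiantsHypothesis.Theorems.BarrierLeverPartitionMinorsHitByVPSimplexJoinBoxGameCubeNoGo

/-!
# Route BarrierLever — item `PartitionMinorsHitByVP` (stmt-ValiantsHypothesis-19717), line `hidden_states`:
# THE CUBE DRAIN — `k` disjoint 2×2×2 cubes are dead up to `r ≤ B₂(hd) + 2k − 2` (drains do not compound across levels)

Helper file (`--supports stmt-ValiantsHypothesis-19717`; cell valiant-natproofs, rung V4, 𝒟-side door (c), line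
`Cruxes/PartitionMinorsHitByVP/Lines/hidden_states.lean` v8, registered stub `stub_simplexPairLower`; prover seat val-np-p3 gen 15).
Definition-free. Closes NO item. Sequel of p666281 (`…BoxGameSquareDrain`: `k` squares dead up to `r ≤ hd + 2k − 1`) and p665496
(`…BoxGameMultiCubeLaw`: static law `r < B_t(hd) + k`).

THE LAW (`not_boxWinning_cubes_drain`, crude floor p647518). For every box-game winning predicate `W` and every `k ≥ 1`: a position with
`k` column-disjoint binary 3-cubes (each inside one piece, every slot reading one cube coordinate) is dead whenever
`r ≤ B₂(hd) + 2k − 2` (`B₂(hd) = 1 + hd + C(hd,2)`) and `hd ≥ 4k + 6`. TIGHT: the exact solver gives `v*(n, k cubes + units) = B₂(n) + 2k − 1`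
(val-np-p3 g15, lab/probe4.py); the static threshold of p665496 is `B₂ + k − 1`, so the dynamic excess is again exactly `k − 1` — the same
as for squares: THE DRAIN DOES NOT COMPOUND from level `t = 1` to `t = 2`.

MECHANISM (one round, no new induction). In the dynamic zone `B₂(hd) + k ≤ r` demand `r₁ = r − B₂(hd−1) ∈ [hd + k, hd + 2k − 2]`
(legal; Pascal `B₂(hd) = B₂(hd−1) + hd`). The big child sits at EXACTLY `B₂(hd−1)`, where a single 3-cube is dead (dimension law,
p661257); the small child sits at `r₁ ≤ (hd−1) + 2k − 1 ≤ B₂(hd−1)`, where a 3-cube is dead too and where `k` disjoint SQUARES are dead by the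
square drain (p666281). Under a one-slot cut every cube is coloured by one coordinate: it goes whole to one child, or splits into two
half-cubes = squares, one per child. So: some cube whole in a child ⇒ that child is dead; otherwise all `k` cubes split and the small child
holds `k` disjoint squares ⇒ dead. Hence no legal answer exists.

WHAT THIS IS NOT: a necessary condition on (crude-floor) winning predicates; the sharp-floor twin and the general tower
(`k` disjoint `(t+1)`-cubes dead up to `B_t(hd) + 2k − 2`, by the same step with the law at `t−1` in the small child) are not typed here;
item 19717 OPEN; nothing on crux 14610 or VP ≠ VNP.
-/

set_option linter.dupNamespace false

namespace Summit.ValiantsHypothesis.ValiantsHypothesis.Theorems.BarrierLever.SimplexJoin.Cut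

open Finset Matrix
open Summit.ValiantsHypothesis.ValiantsHypothesis.Theorems.BarrierLever.HiddenStates

noncomputable section

/-- Pascal for the radius-2 ball: `B₂(n+1) = B₂(n) + (n+1)`. -/
theorem ballTwo_succ (n : ℕ) : 1 + (n + 1) + (n + 1).choose 2 = (1 + n + n.choose 2) + (n + 1) := by
  rw [Nat.choose_succ_succ', Nat.choose_one_right]; ring

/-- `n − 1 ≤ C(n, 2)` for `n ≥ 3`. -/
theorem pred_le_choose_two (n : ℕ) (hn : 3 ≤ n) : n - 1 ≤ n.choose 2 := by
  rw [Nat.choose_two_right, Nat.le_div_iff_mul_le (by norm_num)]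
  have : (n - 1) * 2 ≤ n * (n - 1) := by nlinarith
  exact this

/-- **THE CUBE DRAIN (crude floor).** For every box-game winning predicate `W` (p647518) and every `k ≥ 1`: a position containing `k`
column-disjoint binary 3-cubes `i l : (Fin 3 → Fin 2) → Fin r` (each in one piece, slots reading one coordinate) is NOT a `W`-position
whenever `r + 2 ≤ (1 + hd + C(hd,2)) + 2k` and `4k + 6 ≤ hd`. -/
theorem not_boxWinning_cubes_drain {m D N : ℕ}
    (W : (hd : ℕ) → (r : ℕ) → (Fin r → Fin m × (Fin D → Option (Fin N))) → Prop)
    (hwin : ∀ (hd r : ℕ) (e : Fin r → Fin m × (Fin D → Option (Fin N))), W hd r e → 2 ≤ r → 1 ≤ hd →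
      ∀ r₀ r₁ : ℕ, r₀ + r₁ = r → (r - 2) / hd + 1 ≤ r₁ → r₁ ≤ r₀ → r₀ ≤ 2 ^ (hd - 1) →
        ∃ (f : Fin m → Fin D) (side : Fin m → Option (Fin N) → Bool) (g₀ : Fin r₀ → Fin r) (g₁ : Fin r₁ → Fin r),
          Function.Injective (Sum.elim g₀ g₁) ∧
          (∀ j, side (e (g₀ j)).1 ((e (g₀ j)).2 (f (e (g₀ j)).1)) = false) ∧
          (∀ j, side (e (g₁ j)).1 ((e (g₁ j)).2 (f (e (g₁ j)).1)) = true) ∧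
          W (hd - 1) r₀ (fun j => e (g₀ j)) ∧ W (hd - 1) r₁ (fun j => e (g₁ j)))
    (k : ℕ) (hk : 1 ≤ k) :
    ∀ (r hd : ℕ) (e : Fin r → Fin m × (Fin D → Option (Fin N))) (i : Fin k → (Fin (2 + 1) → Fin 2) → Fin r),
      r + 2 ≤ (1 + hd + hd.choose 2) + 2 * k → 4 * k + 6 ≤ hd →
      (Function.Injective fun lz : Fin k × (Fin (2 + 1) → Fin 2) => i lz.1 lz.2) →
      (∀ l z, (e (i l z)).1 = (e (i l fun _ => 0)).1) →
      (∀ l (φ : Fin D), ∃ c : Fin (2 + 1), ∀ z z', z c = z' c → (e (i l z)).2 φ = (e (i l z')).2 φ) →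
      ¬ W hd r e := by
  intro r hd e i hr hhd hinj hpiece hcb hW
  classical
  have hB2 : (∑ j ∈ Finset.range (2 + 1), hd.choose j) = 1 + hd + hd.choose 2 := by
    simp [Finset.sum_range_succ, Nat.choose_zero_right, Nat.choose_one_right]
  -- the static zone `r < B₂(hd) + k` is the multi-cube law at `t = 2`
  by_cases hstatic : r < (1 + hd + hd.choose 2) + k
  · have hr1 : r < (∑ j ∈ Finset.range (2 + 1), hd.choose j) + k := by rw [hB2]; exact hstatic
    have hr2 : r ≤ ∑ j ∈ Finset.range (2 + 2), hd.choose j := by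
      rw [show (2 + 2 : ℕ) = (2 + 1) + 1 from rfl, Finset.sum_range_succ, hB2]
      -- `C(hd, 3) ≥ hd ≥ 2k`
      have h3 : hd ≤ hd.choose 3 := by
        have hmul : (hd - 1 + 1) * (hd - 1).choose 2 = (hd - 1 + 1).choose (2 + 1) * (2 + 1) :=
          Nat.add_one_mul_choose_eq (hd - 1) 2
        rw [show hd - 1 + 1 = hd by omega] at hmul
        have hc2 : 3 ≤ (hd - 1).choose 2 := by
          have := pred_le_choose_two (hd - 1) (by omega); omega
        have hge : hd * 3 ≤ hd * (hd - 1).choose 2 := Nat.mul_le_mul_left _ hc2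
        rw [hmul] at hge
        have h23 : hd.choose (2 + 1) = hd.choose 3 := rfl
        rw [h23] at hge
        omega
      have : (2 + 1 : ℕ) = 3 := rfl
      rw [this] ; omega
    exact not_boxWinning_cubes W hwin 2 k hk r hd e i hr1 hr2 hinj hpiece hcb hW
  push Not at hstatic
  have hk2 : 2 ≤ k := by omega
  -- Pascal and the demand r₁ = r − B₂(hd−1)
  set B := 1 + (hd - 1) + (hd - 1).choose 2 with hB
  have hPas : 1 + hd + hd.choose 2 = B + hd := by
    have := ballTwo_succ (hd - 1)
    rw [show hd - 1 + 1 = hd by omega] at this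
    rw [hB, this]
  have hBlarge : hd + 2 * k ≤ B := by
    have := pred_le_choose_two (hd - 1) (by omega)
    rw [hB]; omega
  have hBpow : B ≤ 2 ^ (hd - 1) := by rw [hB]; exact one_add_add_choose_two_le_two_pow (hd - 1)
  set r₁ := r - B with hr₁
  have hr₁lo : hd + k ≤ r₁ := by omega
  have hr₁hi : r₁ ≤ hd + 2 * k - 2 := by omega
  have hsum : B + r₁ = r := by omega
  have hfloor : (r - 2) / hd + 1 ≤ r₁ := by
    have hC2 : 2 * hd.choose 2 ≤ hd * hd := by
      rw [Nat.choose_two_right]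
      have h1 : 2 * (hd * (hd - 1) / 2) ≤ hd * (hd - 1) := Nat.mul_div_le _ _
      have h2 : hd * (hd - 1) ≤ hd * hd := Nat.mul_le_mul_left _ (Nat.sub_le _ _)
      omega
    have hZ : 2 * hd + 4 * k ≤ hd * hd := by nlinarith [hhd]
    have hrr : r - 2 ≤ hd * hd := by omega
    have hdiv : (r - 2) / hd ≤ hd := Nat.div_le_of_le_mul (by rw [mul_comm] at hrr; exact hrr)
    omega
  obtain ⟨f, side, g₀, g₁, hg, hfalse, htrue, hW0, hW1⟩ :=
    hwin hd r e hW (by omega) (by omega) B r₁ hsum hfloor (by omega) hBpow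
  set col : Fin r → Bool := fun x => side (e x).1 ((e x).2 (f (e x).1)) with hcol
  have hsurj : Function.Surjective (Sum.elim g₀ g₁) := by
    have hbij := (Fintype.bijective_iff_injective_and_card _).mpr
      ⟨hg, by simp [Fintype.card_sum, Fintype.card_fin]; omega⟩
    exact hbij.2
  have hg₀inj : Function.Injective g₀ := fun a b h => Sum.inl_injective (hg (by simpa using h))
  have hg₁inj : Function.Injective g₁ := fun a b h => Sum.inr_injective (hg (by simpa using h))
  have hfalse_pre : ∀ x, col x = false → ∃ j, g₀ j = x := by
    intro x hx
    obtain ⟨s, hs⟩ := hsurj x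
    rcases s with j | j
    · exact ⟨j, hs⟩
    · have : col x = true := by rw [← hs]; exact htrue j
      rw [hx] at this; exact absurd this (by decide)
  have htrue_pre : ∀ x, col x = true → ∃ j, g₁ j = x := by
    intro x hx
    obtain ⟨s, hs⟩ := hsurj x
    rcases s with j | j
    · have : col x = false := by rw [← hs]; exact hfalse j
      rw [hx] at this; exact absurd this (by decide)
    · exact ⟨j, hs⟩
  -- the colour of a cube column depends on one coordinate
  choose c hc using hcb
  have hcolour : ∀ l (z z' : Fin (2 + 1) → Fin 2), z (c l (f (e (i l fun _ => 0)).1)) = z' (c l (f (e (i l fun _ => 0)).1)) →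
      col (i l z) = col (i l z') := by
    intro l z z' hzz
    have hslot := hc l (f (e (i l fun _ => 0)).1) z z' hzz
    simp only [hcol, hpiece l z, hpiece l z', hslot]
  -- the two static laws available in the children
  have hchild0 : ∀ (i' : (Fin (2 + 1) → Fin 2) → Fin B), Function.Injective i' →
      (∀ z, (e (g₀ (i' z))).1 = (e (g₀ (i' fun _ => 0))).1) →
      (∀ φ : Fin D, ∃ c' : Fin (2 + 1), ∀ z z', z c' = z' c' → (e (g₀ (i' z))).2 φ = (e (g₀ (i' z'))).2 φ) → False := by
    intro i' hi' hp' hc'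
    refine not_boxWinning_hypercube W hwin 2 B (hd - 1) (fun x => e (g₀ x)) i' ?_ hi' hp' hc' hW0
    rw [hB]; simp [Finset.sum_range_succ, Nat.choose_zero_right, Nat.choose_one_right]
  have hchild1cube : ∀ (i' : (Fin (2 + 1) → Fin 2) → Fin r₁), Function.Injective i' →
      (∀ z, (e (g₁ (i' z))).1 = (e (g₁ (i' fun _ => 0))).1) →
      (∀ φ : Fin D, ∃ c' : Fin (2 + 1), ∀ z z', z c' = z' c' → (e (g₁ (i' z))).2 φ = (e (g₁ (i' z'))).2 φ) → False := by
    intro i' hi' hp' hc'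
    refine not_boxWinning_hypercube W hwin 2 r₁ (hd - 1) (fun x => e (g₁ x)) i' ?_ hi' hp' hc' hW1
    have : r₁ ≤ B := by omega
    refine this.trans (le_of_eq ?_)
    rw [hB]; simp [Finset.sum_range_succ, Nat.choose_zero_right, Nat.choose_one_right]
  -- Case 1: some cube is monochromatic ⇒ it survives whole in one child
  by_cases hmono : ∃ l, col (i l fun _ => 0) = col (i l fun _ => 1)
  · obtain ⟨l, hl⟩ := hmono
    have hall : ∀ z, col (i l z) = col (i l fun _ => 0) := by
      intro z
      rcases Fin.exists_fin_two.mp ⟨z (c l (f (e (i l fun _ => 0)).1)), rfl⟩ with h0 | h1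
      · exact hcolour l z (fun _ => 0) h0
      · rw [hl]; exact hcolour l z (fun _ => 1) h1
    cases hc0 : col (i l fun _ => 0) with
    | false =>
      have hpre : ∀ z, ∃ j, g₀ j = i l z := fun z => hfalse_pre _ (by rw [hall z, hc0])
      choose j hj using hpre
      refine hchild0 j (fun z z' h => ?_) (fun z => by simp only [hj]; exact hpiece l z) (fun φ => ?_)
      · have := congrArg g₀ h
        rw [hj, hj] at this
        exact (Prod.ext_iff.mp (hinj (a₁ := (l, z)) (a₂ := (l, z')) this)).2
      · refine ⟨c l φ, fun z z' hzz => ?_⟩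
        simp only [hj]; exact hc l φ z z' hzz
    | true =>
      have hpre : ∀ z, ∃ j, g₁ j = i l z := fun z => htrue_pre _ (by rw [hall z, hc0])
      choose j hj using hpre
      refine hchild1cube j (fun z z' h => ?_) (fun z => by simp only [hj]; exact hpiece l z) (fun φ => ?_)
      · have := congrArg g₁ h
        rw [hj, hj] at this
        exact (Prod.ext_iff.mp (hinj (a₁ := (l, z)) (a₂ := (l, z')) this)).2
      · refine ⟨c l φ, fun z z' hzz => ?_⟩
        simp only [hj]; exact hc l φ z z' hzz
  -- Case 2: every cube splits; its `true` half is a square in the small child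
  push Not at hmono
  -- the `true` bit of cube `l`
  have hbit : ∀ l, ∃ b : Fin 2, col (i l fun _ => b) = true := by
    intro l
    cases h0 : col (i l fun _ => 0) with
    | true => exact ⟨0, h0⟩
    | false =>
      refine ⟨1, ?_⟩
      cases h1 : col (i l fun _ => 1) with
      | true => rfl
      | false => exact absurd (h0.trans h1.symm) (hmono l)
  choose b hb using hbit
  -- the square: coordinate `c₀ l` frozen at `b l`
  let c₀ : Fin k → Fin (2 + 1) := fun l => c l (f (e (i l fun _ => 0)).1)
  let sq : Fin k → (Fin (1 + 1) → Fin 2) → (Fin (2 + 1) → Fin 2) := fun l z' =>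
    Fin.insertNth (α := fun _ => Fin 2) (c₀ l) (b l) z'
  have hsq_true : ∀ l z', col (i l (sq l z')) = true := by
    intro l z'
    have h1 : (sq l z') (c₀ l) = (fun _ : Fin (2 + 1) => b l) (c₀ l) := by
      simp only [sq, Fin.insertNth_apply_same]
    rw [hcolour l (sq l z') (fun _ => b l) h1]
    exact hb l
  have hpre : ∀ l z', ∃ j, g₁ j = i l (sq l z') := fun l z' => htrue_pre _ (hsq_true l z')
  choose j hj using hpre
  refine not_boxWinning_squares_drain W hwin k hk r₁ (hd - 1) (fun x => e (g₁ x)) j (by omega) (by omega) ?_ ?_ ?_ hW1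
  · rintro ⟨l, z⟩ ⟨l', z'⟩ h
    have h' : i l (sq l z) = i l' (sq l' z') := by
      have := congrArg g₁ h
      simpa only [hj] using this
    have hll := hinj (a₁ := (l, sq l z)) (a₂ := (l', sq l' z')) h'
    simp only [Prod.mk.injEq] at hll
    obtain ⟨rfl, hzz⟩ := hll
    have hzz' : Fin.insertNth (α := fun _ => Fin 2) (c₀ l) (b l) z = Fin.insertNth (α := fun _ => Fin 2) (c₀ l) (b l) z' := hzz
    have : z = z' := Fin.insertNth_right_injective (α := fun _ => Fin 2) (p := c₀ l) (b l) hzz'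
    rw [this]
  · intro l z'
    simp only [hj]
    rw [hpiece l (sq l z'), hpiece l (sq l fun _ => 0)]
  · intro l φ
    by_cases hφ : c l φ = c₀ l
    · -- the slot reads the frozen coordinate: constant on the square
      refine ⟨0, fun z z' _ => ?_⟩
      simp only [hj]
      refine hc l φ _ _ ?_
      rw [hφ]
      simp only [sq, Fin.insertNth_apply_same]
    · obtain ⟨c', hc'⟩ := Fin.exists_succAbove_eq hφ
      refine ⟨c', fun z z' hzz => ?_⟩
      simp only [hj]
      refine hc l φ _ _ ?_
      rw [← hc']
      simp only [sq, Fin.insertNth_apply_succAbove]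
      exact hzz

end

end Summit.ValiantsHypothesis.ValiantsHypothesis.Theorems.BarrierLever.SimplexJoin.Cut
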